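import Literature.Computation.Certificates.KeyedGramStreamWindows
import Literature.Computation.Certificates.SumOfSquares

/-!
# Table contribution streams: the multiplier products of a large identity in the «K-STREAM» lane

The kind-1 entries of a K-STREAM entry stream (`Entry.tab id`, see `KeyedGramStream`) carry the
products of a Gram-form Positivstellensatz certificate `p = σ₀ + Σᵢ gᵢ·σᵢ + Σⱼ hⱼ·μⱼ` OTHER than the
big free block `σ₀`: every single product term `(term α of μⱼ) · (term τ of hⱼ)` and
`Q^{(i)}_{ab} · m_a m_b · (term τ of gᵢ)` is ONE contribution, identified by a dense id, whose key
and integer coefficient the kernel recomputes by random access into small packed tables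
(`Family`, `TabCtx.contrib`) — so the certificate can interleave these contributions with the
Gram entries in ONE key-sorted stream and the group-sum walk cancels everything against the
target `Λ·p` key by key, with no product polynomial ever expanded into a literal.

As for the Gram entries, «every contribution exactly once» is two table look-ups checked both
ways: a position-by-id table (`tabPosAt`, checked by `idPass` for every id of every family) and an
id-by-position table (`dAt`, checked together with the first-index marker `s` at every table entry
by the extra stream pass `tabSidePass`). The client's polynomials `p`, `gᵢ`, `hⱼ` stay in the
`SOS.Poly` vocabulary of `SumOfSquares`/`GramSOS`: `keyedOf` converts an exponent-list polynomial
to keyed terms inside the kernel (small data only) and `eval_keyedOf` is the bridge.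
[cite: BlekhermanParriloThomas2012, §3.1.4 eq. (3.12), p. 64; Thm 3.39, p. 65]; Kronecker codes
[cite: Harvey2009, §3.1].

WHAT THIS FILE IS NOT: definitions only (the kernel's functions); soundness and the
Positivstellensatz assembly are `KeyedTableStreamSound`. Not an emitter (that is `certsdp.sos`).
-/

namespace Literature.Computation.Certificates

namespace SOS

namespace Keyed

open PSD

/-! ### Packed small polynomials -/

/-- A **packed term table**: `n` terms, keys of `wk` bits each in `K`, coefficients as
sign–magnitude digits of `1 + wc` bits each in `C` (low bit = sign, `1` = negative).
[cite: Harvey2009, §3.1] -/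
structure PTab where
  /-- number of terms -/
  n : ℕ
  /-- bits per key -/
  wk : ℕ
  /-- packed keys -/
  K : ℕ
  /-- bits per coefficient digit (sign bit included) -/
  wc : ℕ
  /-- packed sign–magnitude coefficients -/
  C : ℕ

namespace PTab

/-- Key of term `t`. [cite: Harvey2009, §3.1] -/
def key (T : PTab) (t : ℕ) : ℕ := bigDigit T.wk T.K t

/-- Sign of term `t` (`true` = nonnegative). [cite: Harvey2009, §3.1] -/
def sgn (T : PTab) (t : ℕ) : Bool := bigDigit T.wc T.C t % 2 == 0

/-- Magnitude of term `t`. [cite: Harvey2009, §3.1] -/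
def mag (T : PTab) (t : ℕ) : ℕ := bigDigit T.wc T.C t / 2

/-- The table as a sign–magnitude term list (specification; small). [cite: Harvey2009, §3.1] -/
def toSTerms (T : PTab) : STerms := (List.range T.n).map fun t => (T.key t, T.sgn t, T.mag t)

end PTab

/-! ### Product families and the table context -/

/-- **One product family** of the certificate. `ineq = false`: an EQUALITY family `μ · h` with
`A` = the multiplier `μ` (packed terms) and `T` = the hypothesis `h`; ids `α·|T| + τ`.
`ineq = true`: an INEQUALITY family `g · σ` with `σ = m_σᵀ Q m_σ`: `A` holds the KEYS of the basis
`m_σ` (its coefficient field unused), `Q` = packed rows of the integer matrix `L_σ·Q` (`wq`-bit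
offset digits, exactly the `Arows` of the packed rows PSD lane), `T` = the hypothesis `g`; ids
`(a·s_σ + b)·|T| + τ` for `a ≤ b` (other ids are invalid and never used). `cf` = the family's
cofactor bringing its integers to the common scale `Λ` of the identity; `off` = first global id.
[cite: BlekhermanParriloThomas2012, Thm 3.39, p. 65] -/
structure Family where
  /-- inequality family (`g·σ`) or equality family (`μ·h`) -/
  ineq : Bool
  /-- multiplier terms `μ` (EQ) / basis keys of `σ` (INEQ) -/
  A : PTab
  /-- packed rows of `L_σ·Q` (INEQ only) -/
  Q : List ℕ
  /-- bits per `Q` digit -/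
  wq : ℕ
  /-- the hypothesis polynomial (`h` or `g`), packed -/
  T : PTab
  /-- cofactor to the common scale -/
  cf : ℕ
  /-- first global id of this family -/
  off : ℕ
  /-- index of the hypothesis in the client's list `hs` (EQ) / `gs` (INEQ) -/
  hyp : ℕ
  /-- the integer scale of the hypothesis table: `T = keyedZ b D (hs[hyp])` resp. `gs[hyp]` -/
  D : ℕ

namespace Family

/-- Number of local ids. [folklore] -/
def size (F : Family) : ℕ := if F.ineq then F.A.n * F.A.n * F.T.n else F.A.n * F.T.n

/-- `Q` digit at `(a, b)` (INEQ families). [cite: Harvey2009, §3.1] -/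
def qAt (F : Family) (a b : ℕ) : ℕ := bigDigit F.wq (F.Q.getD a 0) b

/-- **The contribution of local id `l`** as `(key, sign, magnitude)`; invalid INEQ ids (`a > b`)
yield magnitude `0`. Signs combine by `xor`, magnitudes multiply — `ℕ` only.
[cite: BlekhermanParriloThomas2012, §3.1.4 eq. (3.12), p. 64] -/
def contribLocal (F : Family) (l : ℕ) : ℕ × Bool × ℕ :=
  let τ := l % F.T.n
  let α := l / F.T.n
  if F.ineq then
    let a := α / F.A.n
    let b := α % F.A.n
    let d := F.qAt a b
    let off := 2 ^ (F.wq - 1)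
    let qs : Bool := decide (off ≤ d)          -- sign of Q_ab
    let qm := if off ≤ d then d - off else off - d
    (F.A.key a + F.A.key b + F.T.key τ, (qs == F.T.sgn τ), if a ≤ b then F.cf * mult a b * qm * F.T.mag τ else 0)
  else
    (F.A.key α + F.T.key τ, (F.A.sgn α == F.T.sgn τ), F.cf * F.A.mag α * F.T.mag τ)

end Family

/-- **Table context**: the product families (in id order) and their total id count — the
multiplier side `Σᵢ gᵢσᵢ + Σⱼ hⱼμⱼ` of a Gram-form certificate. [cite: BlekhermanParriloThomas2012, Thm 3.39, p. 65] -/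
structure TabCtx where
  /-- the families, by increasing `off` -/
  fams : List Family
  /-- total number of ids -/
  NU : ℕ

namespace TabCtx

/-- Find the family of a global id (linear scan; `none` past the last family). [folklore] -/
def findFam : List Family → ℕ → Option Family
  | [], _ => none
  | F :: Fs, id => if id < F.off + F.size then some F else findFam Fs id

/-- **The contribution function** handed to `terms`: global id ↦ `(key, sign, magnitude)`;
ids outside every family contribute `0`. [cite: BlekhermanParriloThomas2012, §3.1.4 eq. (3.12), p. 64] -/
def contrib (t : TabCtx) (id : ℕ) : ℕ × Bool × ℕ :=
  match findFam t.fams id with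
  | none => (0, true, 0)
  | some F => F.contribLocal (id - F.off)

/-- Offsets are consecutive from `0` and add up to `NU`. [folklore] -/
def offsOK (t : TabCtx) : Bool :=
  go 0 t.fams
where
  /-- offsets scan -/
  go : ℕ → List Family → Bool
  | acc, [] => acc == t.NU
  | acc, F :: Fs => (F.off == acc) && go (acc + F.size) Fs

end TabCtx

/-! ### The table side pass and the id pass -/

/-- **Id tables**: position by id (`Tpos`, `wp`-bit digits, `G` ids per numeral, grouped by `R`)
and id by position (`Dtab`, `wd`-bit digits, `G` positions per numeral, grouped by `R`).
[cite: Harvey2009, §3.1] -/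
structure TabSide where
  /-- numerals per group -/
  R : ℕ
  /-- entries per numeral -/
  G : ℕ
  /-- bits per position digit -/
  wp : ℕ
  /-- position-by-id table -/
  Tpos : List (List ℕ)
  /-- bits per id digit -/
  wd : ℕ
  /-- id-by-position table -/
  Dtab : List (List ℕ)

namespace TabSide

/-- Recorded stream position of id `id`. [cite: Harvey2009, §3.1] -/
def tabPosAt (e : TabSide) (id : ℕ) : ℕ := bigDigit e.wp (getD2 e.Tpos e.R (id / e.G)) (id % e.G)

/-- Recorded id at stream position `π`. [cite: Harvey2009, §3.1] -/
def dAt (e : TabSide) (π : ℕ) : ℕ := bigDigit e.wd (getD2 e.Dtab e.R (π / e.G)) (π % e.G)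

end TabSide

/-- Table side condition of ONE entry at position `π`: a table entry's id is in range, its
recorded position is `π`, the id table at `π` reads `id`, and the first-index table reads the
marker `s` (Gram entries: nothing further here — `sidePass` covers them). [cite: BlekhermanParriloThomas2012, §3.1.4 eq. (3.12), p. 64] -/
def tabSideEntry (c : GramCtx) (d : SideCtx) (t : TabCtx) (e : TabSide) (π : ℕ) : Entry → Bool
  | Entry.gram _ _ _ _ => true
  | Entry.tab id => decide (id < t.NU) && (e.tabPosAt id == π) && (e.dAt π == id) && (d.iAt c.wi π == c.s)

/-- Table side pass over decoded entries from position `π` on. [folklore] -/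
def tabSideList (c : GramCtx) (d : SideCtx) (t : TabCtx) (e : TabSide) : ℕ → List Entry → Bool
  | _, [] => true
  | π, en :: rest => tabSideEntry c d t e π en && tabSideList c d t e (π + 1) rest

/-- **The table side pass** over a chunk list whose first entry has global position `π₀`.
[cite: BlekhermanParriloThomas2012, §3.1.4 eq. (3.12), p. 64] -/
def tabSidePass (c : GramCtx) (d : SideCtx) (t : TabCtx) (e : TabSide) (π₀ : ℕ) (chunks : List (ℕ × ℕ)) : Bool :=
  tabSideList c d t e π₀ (entries c chunks)

/-- Ids `id, id+1, …` (fuel `k`): VALID ids point below `P` at a position whose first-index table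
reads `≥ s` (a table entry) and whose id table reads `id`; INVALID INEQ ids (`a > b`) are skipped.
[cite: BlekhermanParriloThomas2012, §3.1.4 eq. (3.12), p. 64] -/
def idRange (c : GramCtx) (d : SideCtx) (e : TabSide) (F : Family) (P : ℕ) : ℕ → ℕ → Bool
  | 0, _ => true
  | k + 1, l =>
    (if F.ineq && decide (l / F.T.n % F.A.n < l / F.T.n / F.A.n) then true else
      let π := e.tabPosAt (F.off + l)
      decide (π < P) && decide (c.s ≤ d.iAt c.wi π) && (e.dAt π == F.off + l)) &&
    idRange c d e F P k (l + 1)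

/-- The id pass over all families. [folklore] -/
def idFams (c : GramCtx) (d : SideCtx) (e : TabSide) (P : ℕ) : List Family → Bool
  | [] => true
  | F :: Fs => idRange c d e F P F.size 0 && idFams c d e P Fs

/-- **The id pass**: every valid id of every family has its entry in the stream. `P` = total
number of stream entries. [cite: BlekhermanParriloThomas2012, §3.1.4 eq. (3.12), p. 64] -/
def idPass (c : GramCtx) (d : SideCtx) (t : TabCtx) (e : TabSide) (P : ℕ) : Bool :=
  t.offsOK && idFams c d e P t.fams

/-! ### Bridge from `SOS.Poly` (exponent lists) to keyed terms -/

/-- Kronecker code of an exponent list in base `b`. [cite: Harvey2009, §3.1] -/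
def keyOfMono (b : ℕ) : Monomial → ℕ
  | [] => 0
  | e :: es => e + b * keyOfMono b es

/-- **Keyed form of an `SOS.Poly`** (same term order; rational coefficients).
[cite: Harvey2009, §3.1] -/
def keyedOf (b : ℕ) (p : Poly) : List (ℕ × ℚ) := p.map fun t => (keyOfMono b t.1, t.2)

/-- The keyed form scaled to integers by `Λ`, as sign–magnitude terms (same term order); `none` if
some `Λ·c` is not an integer. [cite: Harvey2009, §3.1] -/
def keyedZ (b Λ : ℕ) : Poly → Option STerms
  | [] => some []
  | (m, c) :: p =>
    match keyedZ b Λ p with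
    | none => none
    | some T =>
      let q : ℚ := (Λ : ℚ) * c
      if q.den = 1 then some ((keyOfMono b m, decide (0 ≤ q.num), q.num.natAbs) :: T) else none

/-- Every exponent `< D + 1 ≤ b`… precisely: all exponents `≤ D` and every monomial has at most `n`
entries (so that `keyOfMono` codes are faithful on `n` variables with digit bound `D`).
[cite: Harvey2009, §3.1] -/
def polyOK (D n : ℕ) (p : Poly) : Bool :=
  p.all fun t => decide (t.1.length ≤ n) && t.1.all fun e => decide (e ≤ D)

end Keyed

end SOS

end Literature.Computation.Certificates
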